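import Literature.MathematicalPhysics.QuantumLattice.DuhamelTwoPoint
import Literature.MathematicalPhysics.QuantumLattice.GibbsTwoTimeBound
import Literature.MathematicalPhysics.QuantumLattice.SectorSpectrum
import HarnessLib

/-!
# Route `JosephsonMirror` — Markov selection of an eigenvector from a Gibbs state

Helper file (`--supports` stmt-HubbardSuperconductivity-2228, crux `JmCusp`, line `cocountable-coupling-selection`,
stub `stub_logColdGivesWindowOrder`) for route `JosephsonMirror` (sub-problem `HubbardSuperconductivity`):
the abstract, finite-dimensional core of "cold Gibbs order ⇒ zero-excess order".

* `gibbsMarkovSelection` (registered form) / `exists_eigenvector_of_gibbsState_le` — for a Hermitian `K` on a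
  nonempty finite index type, an observable `O` whose quadratic form is bounded by `M` on unit vectors, an
  inverse temperature `β > 0` and a threshold `t > 0`: if the Gibbs average `Re ⟨O⟩_β ≥ m`, then some
  EIGENVECTOR `u` of `K` (a column of the spectral-theorem unitary) has eigenvalue within `t` of the bottom of the
  spectrum AND `Re ⟨u, O u⟩ ≥ m - M · (log(card)/β) / t`.  Proof: in the eigenbasis the Gibbs state is the
  probability vector `wᵢ = e^{-βλᵢ}/Z` (`trace_gibbsWeight_mul_eq_sum`, `partitionFn_eq_sum_exp`); the
  energy–entropy bound `Σ wᵢ λᵢ ≤ λ_min + log(card)/β` (`sum_boltzmann_mul_le`) and Markov give total weight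
  `≤ (log(card)/β)/t` above `λ_min + t`, so the low eigenvectors still carry `Σ wᵢ oᵢ ≥ m - M ℓ/t`, and the best of
  them is at least that large.
* `blockExt` bookkeeping (`star_blockExt_dotProduct_blockExt`, `star_dotProduct_toBlock_mulVec`,
  `mulVec_blockExt_of_offBlock_eq_zero`, `blockExt_apply_of_not`): extension by zero from a coordinate block,
  relating `Matrix.toBlock p p` to the full matrix (as in `sector_groundState`).

Sources: T. Koma, H. Tasaki, J. Stat. Phys. 76 (1994) 745, §2 (order parameters from states of vanishing excess
energy); H. Tasaki, *Physics and Mathematics of Quantum Many-Body Systems* (2020), App. A (Gibbs states in the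
eigenbasis, `⟨H⟩_β ≤ E₀ + log(dim)/β`).  Folklore; no new definitions besides the abbreviation-free statements.
-/

noncomputable section

-- the mandated namespace `Summit.<Summit>.<Problem>.Theorems` repeats `HubbardSuperconductivity`
-- (single-problem summit, D-0017), which the `dupNamespace` linter flags on every declaration
set_option linter.dupNamespace false

namespace Summit.HubbardSuperconductivity.HubbardSuperconductivity.Theorems.JosephsonMirror

open Matrix Literature.MathematicalPhysics.QuantumLattice
open scoped ComplexOrder

/-! ### The Gibbs state in the eigenbasis -/

section Eigenbasis

variable {V : Type*} [Fintype V] [DecidableEq V]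

omit [DecidableEq V] in
/-- The `i`-th diagonal entry of `U⋆ O U` is the quadratic form of `O` at the `i`-th column of `U`. [folklore] -/
theorem star_mul_mul_apply_self (U O : Matrix V V ℂ) (i : V) :
    (star U * O * U) i i = star (fun a => U a i) ⬝ᵥ O *ᵥ (fun a => U a i) := by
  simp only [mul_apply, star_apply, dotProduct, mulVec, Pi.star_apply, Finset.sum_mul, Finset.mul_sum]
  rw [Finset.sum_comm]
  refine Finset.sum_congr rfl fun a _ => Finset.sum_congr rfl fun b _ => ?_
  ring

/-- The columns of the spectral-theorem unitary are unit vectors. [folklore] -/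
theorem star_eigencol_dotProduct_self {K : Matrix V V ℂ} (hK : K.IsHermitian) (i : V) :
    star (fun a => (hK.eigenvectorUnitary : Matrix V V ℂ) a i) ⬝ᵥ
      (fun a => (hK.eigenvectorUnitary : Matrix V V ℂ) a i) = 1 := by
  have h := congrFun (congrFun (Unitary.coe_star_mul_self hK.eigenvectorUnitary) i) i
  rw [one_apply_eq] at h
  rw [← h]
  simp only [mul_apply, star_apply, dotProduct, Pi.star_apply]

/-- The columns of the spectral-theorem unitary are eigenvectors. [folklore] -/
theorem mulVec_eigencol {K : Matrix V V ℂ} (hK : K.IsHermitian) (i : V) :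
    K *ᵥ (fun a => (hK.eigenvectorUnitary : Matrix V V ℂ) a i) =
      ((hK.eigenvalues i : ℝ) : ℂ) • (fun a => (hK.eigenvectorUnitary : Matrix V V ℂ) a i) := by
  have h : (fun a => (hK.eigenvectorUnitary : Matrix V V ℂ) a i) = ⇑(hK.eigenvectorBasis i) :=
    funext fun a => IsHermitian.eigenvectorUnitary_apply hK a i
  rw [h, hK.mulVec_eigenvectorBasis i, RCLike.real_smul_eq_coe_smul (K := ℂ)]
  rfl

/-- **Markov selection of an eigenvector from a Gibbs state.**  `K` Hermitian on a nonempty finite index type,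
`O` with `0 ≤ Re ⟨u, O u⟩ ≤ M` on unit vectors, `β > 0`, `t > 0`, `Re ⟨O⟩_{β,K} ≥ m`.  Then some column `u` of the eigenvector unitary of `K` has eigenvalue
`≤ λ_min + t` (for every eigenvalue `λ_min` means: `≤ λⱼ + t` for all `j`) and `Re ⟨u, O u⟩ ≥ m - M (log(card)/β)/t`.
Koma–Tasaki (1994) §2; Tasaki (2020) App. A. [folklore] -/
theorem exists_eigenvector_of_gibbsState_le [Nonempty V] {K : Matrix V V ℂ} (hK : K.IsHermitian)
    (O : Matrix V V ℂ) {M : ℝ} (hO0 : ∀ u : V → ℂ, star u ⬝ᵥ u = 1 → 0 ≤ (star u ⬝ᵥ O *ᵥ u).re)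
    (hOM : ∀ u : V → ℂ, star u ⬝ᵥ u = 1 → (star u ⬝ᵥ O *ᵥ u).re ≤ M)
    {β : ℝ} (hβ : 0 < β) {t : ℝ} (ht : 0 < t) {m : ℝ} (hm : m ≤ (gibbsState β K O).re) :
    ∃ i : V, (∀ j : V, hK.eigenvalues i ≤ hK.eigenvalues j + t) ∧
      m - M * (Real.log (Fintype.card V) / β) / t ≤
        (star (fun a => (hK.eigenvectorUnitary : Matrix V V ℂ) a i) ⬝ᵥ
          O *ᵥ (fun a => (hK.eigenvectorUnitary : Matrix V V ℂ) a i)).re := by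
  classical
  set lam : V → ℝ := hK.eigenvalues with hlam
  set U : Matrix V V ℂ := (hK.eigenvectorUnitary : Matrix V V ℂ) with hU
  set col : V → V → ℂ := fun i a => U a i with hcol
  set o : V → ℝ := fun i => (star (col i) ⬝ᵥ O *ᵥ col i).re with ho
  set ℓ : ℝ := Real.log (Fintype.card V) / β with hℓ
  -- Boltzmann weights
  set e : V → ℝ := fun i => Real.exp (-(β * lam i)) with he
  set Z : ℝ := ∑ i, e i with hZ
  have he0 : ∀ i, 0 < e i := fun i => Real.exp_pos _
  have hZpos : 0 < Z := Finset.sum_pos (fun i _ => he0 i) Finset.univ_nonempty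
  set w : V → ℝ := fun i => e i / Z with hw
  have hw0 : ∀ i, 0 ≤ w i := fun i => div_nonneg (he0 i).le hZpos.le
  have hw1 : ∑ i, w i = 1 := by
    rw [hw]; simp only; rw [← Finset.sum_div, ← hZ, div_self hZpos.ne']
  -- the bottom eigenvalue
  obtain ⟨i₀, hi₀⟩ := exists_eq_ciInf_of_finite (f := lam)
  have hmin : ∀ j, lam i₀ ≤ lam j := by
    intro j; rw [hi₀]; exact ciInf_le (Set.finite_range _).bddBelow j
  -- energy–entropy: `Σ wᵢ (λᵢ - λ_min) ≤ ℓ`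
  have hEE : ∑ i, w i * (lam i - lam i₀) ≤ ℓ := by
    have h := sum_boltzmann_mul_le hβ lam i₀
    have h1 : ∑ i, w i * (lam i - lam i₀) = (∑ i, Real.exp (-(β * lam i)))⁻¹ *
        ∑ i, Real.exp (-(β * lam i)) * lam i - lam i₀ := by
      rw [Finset.mul_sum]
      have : ∑ i, w i * (lam i - lam i₀) = ∑ i, w i * lam i - (∑ i, w i) * lam i₀ := by
        rw [Finset.sum_mul, ← Finset.sum_sub_distrib]
        refine Finset.sum_congr rfl fun i _ => by ring
      rw [this, hw1, one_mul]
      congr 1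
      refine Finset.sum_congr rfl fun i _ => ?_
      rw [hw, he, hZ]
      simp only
      rw [div_eq_inv_mul, mul_assoc]
    rw [h1]
    linarith
  -- the observable: `Re ⟨O⟩ = Σ wᵢ oᵢ`
  have hobs : (gibbsState β K O).re = ∑ i, w i * o i := by
    rw [gibbsState_apply, partitionFn_eq_sum_exp β hK, trace_gibbsWeight_mul_eq_sum hK β O]
    have hZc : (∑ i, (Real.exp (-β * hK.eigenvalues i) : ℂ)) = ((Z : ℝ) : ℂ) := by
      rw [hZ, Complex.ofReal_sum]
      refine Finset.sum_congr rfl fun i _ => ?_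
      rw [he, hlam]
      push_cast
      ring_nf
    rw [hZc, ← Complex.ofReal_inv, Finset.mul_sum, Complex.re_sum]
    refine Finset.sum_congr rfl fun i _ => ?_
    rw [← mul_assoc, ← Complex.ofReal_mul, Complex.re_ofReal_mul, star_mul_mul_apply_self, hw, ho, hcol,
      he]
    simp only
    rw [div_eq_inv_mul, hlam]
    congr 2
    congr 2
    ring
  -- weights above the threshold
  set B : Finset V := Finset.univ.filter fun i => lam i₀ + t < lam i with hB
  have hWB : (∑ i ∈ B, w i) * t ≤ ℓ := by
    calc (∑ i ∈ B, w i) * t = ∑ i ∈ B, w i * t := Finset.sum_mul _ _ _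
      _ ≤ ∑ i ∈ B, w i * (lam i - lam i₀) := Finset.sum_le_sum fun i hi => by
          have hi' : lam i₀ + t < lam i := (Finset.mem_filter.mp hi).2
          exact mul_le_mul_of_nonneg_left (by linarith) (hw0 i)
      _ ≤ ∑ i, w i * (lam i - lam i₀) :=
          Finset.sum_le_univ_sum_of_nonneg fun i => mul_nonneg (hw0 i) (by linarith [hmin i])
      _ ≤ ℓ := hEE
  -- the unit columns and the bound `oᵢ ≤ M`
  have hcol1 : ∀ i, star (col i) ⬝ᵥ col i = 1 := fun i => star_eigencol_dotProduct_self hK i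
  have hoM : ∀ i, o i ≤ M := fun i => hOM (col i) (hcol1 i)
  -- split the Gibbs average along `B`
  have hsplit : ∑ i, w i * o i = ∑ i ∈ B, w i * o i + ∑ i ∈ Bᶜ, w i * o i :=
    (Finset.sum_add_sum_compl B _).symm
  have hM0 : 0 ≤ M := (hO0 (col i₀) (hcol1 i₀)).trans (hoM i₀)
  have ho0 : ∀ i, 0 ≤ o i := fun i => hO0 (col i) (hcol1 i)
  have hBpart : ∑ i ∈ B, w i * o i ≤ M * (ℓ / t) := by
    calc ∑ i ∈ B, w i * o i ≤ ∑ i ∈ B, w i * M :=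
          Finset.sum_le_sum fun i _ => mul_le_mul_of_nonneg_left (hoM i) (hw0 i)
      _ = (∑ i ∈ B, w i) * M := (Finset.sum_mul _ _ _).symm
      _ ≤ (ℓ / t) * M := by
          refine mul_le_mul_of_nonneg_right ?_ hM0
          rw [le_div_iff₀ ht]
          exact hWB
      _ = M * (ℓ / t) := mul_comm _ _
  -- the complement is nonempty (it contains `i₀`) and carries the rest
  have hi₀B : i₀ ∈ Bᶜ := by
    rw [Finset.mem_compl, hB, Finset.mem_filter, not_and]
    intro _ h; linarith
  obtain ⟨i, hiB, himax⟩ := Finset.exists_max_image Bᶜ o ⟨i₀, hi₀B⟩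
  have hrest : m - M * (ℓ / t) ≤ ∑ j ∈ Bᶜ, w j * o j := by
    have := hm; rw [hobs, hsplit] at this; linarith
  refine ⟨i, fun j => ?_, ?_⟩
  · have hi' : ¬ (lam i₀ + t < lam i) := by
      have := Finset.mem_compl.mp hiB
      rw [hB, Finset.mem_filter, not_and] at this
      exact this (Finset.mem_univ _)
    have hi'' := not_lt.mp hi'
    linarith [hmin j]
  · have hle : ∑ j ∈ Bᶜ, w j * o j ≤ ∑ j ∈ Bᶜ, w j * o i :=
      Finset.sum_le_sum fun j hj => mul_le_mul_of_nonneg_left (himax j hj) (hw0 j)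
    rw [← Finset.sum_mul] at hle
    have hWc : ∑ j ∈ Bᶜ, w j ≤ 1 := by
      rw [← hw1]; exact Finset.sum_le_univ_sum_of_nonneg fun j => hw0 j
    have h1 : (∑ j ∈ Bᶜ, w j) * o i ≤ o i := by
      calc (∑ j ∈ Bᶜ, w j) * o i ≤ 1 * o i := mul_le_mul_of_nonneg_right hWc (ho0 i)
        _ = o i := one_mul _
    change m - M * (Real.log (Fintype.card V) / β) / t ≤ o i
    rw [mul_div_assoc]
    linarith

end Eigenbasis

/-! ### Extension by zero from a coordinate block -/

section Block

variable {ι : Type*} [Fintype ι] (p : ι → Prop) [DecidablePred p]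

/-- Inner products against an extension by zero are block sums. [folklore] -/
theorem star_blockExt_dotProduct (u : {a // p a} → ℂ) (w : ι → ℂ) :
    star (fun i => if h : p i then u ⟨i, h⟩ else 0) ⬝ᵥ w = star u ⬝ᵥ fun a => w a.1 := by
  rw [dotProduct, dotProduct, sum_eq_sum_subtype_of_support p]
  · refine Finset.sum_congr rfl fun a _ => ?_
    simp only [Pi.star_apply, a.2, dif_pos]
  · intro j hj
    simp only [Pi.star_apply, hj, dif_neg, not_false_eq_true, star_zero, zero_mul]

/-- The block of a matrix acts on block vectors as the matrix acts on their extensions by zero, read on the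
block. [folklore] -/
theorem toBlock_mulVec_apply (O : Matrix ι ι ℂ) (u : {a // p a} → ℂ) (a : {a // p a}) :
    (O.toBlock p p *ᵥ u) a = (O *ᵥ fun i => if h : p i then u ⟨i, h⟩ else 0) a.1 := by
  rw [mulVec, mulVec, dotProduct, dotProduct, sum_eq_sum_subtype_of_support p]
  · refine Finset.sum_congr rfl fun b _ => ?_
    simp only [toBlock_apply, b.2, dif_pos]
  · intro j hj
    simp only [hj, dif_neg, not_false_eq_true, mul_zero]

/-- The quadratic form of a block is the quadratic form of the matrix at the extension by zero. [folklore] -/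
theorem star_dotProduct_toBlock_mulVec (O : Matrix ι ι ℂ) (u : {a // p a} → ℂ) :
    star u ⬝ᵥ (O.toBlock p p *ᵥ u) =
      star (fun i => if h : p i then u ⟨i, h⟩ else 0) ⬝ᵥ
        (O *ᵥ fun i => if h : p i then u ⟨i, h⟩ else 0) := by
  rw [star_blockExt_dotProduct]
  congr 1
  funext a
  exact toBlock_mulVec_apply p O u a

/-- A matrix with no entries from the block's complement into the block maps extensions by zero to extensions by
zero: `H (ext u) = ext (H_block u)`. [folklore] -/
theorem mulVec_blockExt_of_offBlock_eq_zero (H : Matrix ι ι ℂ) (hinv : ∀ i j, ¬ p i → p j → H i j = 0)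
    (u : {a // p a} → ℂ) :
    (H *ᵥ fun i => if h : p i then u ⟨i, h⟩ else 0) =
      fun i => if h : p i then (H.toBlock p p *ᵥ u) ⟨i, h⟩ else 0 := by
  funext i
  by_cases hi : p i
  · rw [dif_pos hi, toBlock_mulVec_apply]
  · rw [dif_neg hi, mulVec, dotProduct]
    refine Finset.sum_eq_zero fun j _ => ?_
    by_cases hj : p j
    · rw [hinv i j hi hj, zero_mul]
    · simp only [hj, dif_neg, not_false_eq_true, mul_zero]

end Block



/-! ### Registered form -/

/-- **Markov selection of an eigenvector from a Gibbs state** — closed (registered) form of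
`exists_eigenvector_of_gibbsState_le`.  Koma–Tasaki (1994) §2; Tasaki (2020) App. A. [folklore] -/
theorem gibbsMarkovSelection : ∀ {V : Type} [Fintype V] [DecidableEq V] [Nonempty V] {K : Matrix V V ℂ} (hK : K.IsHermitian) (O : Matrix V V ℂ) (M β t m : ℝ), (∀ u : V → ℂ, star u ⬝ᵥ u = 1 → 0 ≤ (star u ⬝ᵥ Matrix.mulVec O u).re) → (∀ u : V → ℂ, star u ⬝ᵥ u = 1 → (star u ⬝ᵥ Matrix.mulVec O u).re ≤ M) → 0 < β → 0 < t → m ≤ (Matrix.gibbsState β K O).re → ∃ i : V, (∀ j : V, hK.eigenvalues i ≤ hK.eigenvalues j + t) ∧ m - M * (Real.log (Fintype.card V) / β) / t ≤ (star (fun a => (hK.eigenvectorUnitary : Matrix V V ℂ) a i) ⬝ᵥ Matrix.mulVec O (fun a => (hK.eigenvectorUnitary : Matrix V V ℂ) a i)).re :=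
  fun hK O _ _ _ _ hO0 hOM hβ ht hm => exists_eigenvector_of_gibbsState_le hK O hO0 hOM hβ ht hm

end Summit.HubbardSuperconductivity.HubbardSuperconductivity.Theorems.JosephsonMirror

end
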